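import Literature.NumberTheory.LFunctions.ZetaArgVariation
import Literature.NumberTheory.LFunctions.XiDerivativeZerosCounting
import Literature.NumberTheory.LFunctions.LagariasXiPositivityEq14Proofs
import Literature.NumberTheory.LFunctions.SuzukiSingleOperatorKernelProofs
import Literature.NumberTheory.LFunctions.ZetaScrewGrowthMomentsProofs
import Mathlib.Analysis.Complex.Liouville
import HarnessLib

/-!
# The zero-counting function of `ξ′`: `N^{(1)}(T) = N(T) + O(log T)` (Conrey 1983, Lemma 2, `m = 1`)

RH-FREE (every statement below is an unconditional theorem of this tree; «nothing here bears on the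
truth of RH»). Topic `Literature/NumberTheory/LFunctions`, namespace `Literature.NumberTheory.LFunctions`
(helpers in `XiDerivArg`). PROOF LAYER for `XiDerivativeZeros.lean` (J. B. Conrey, *Zeros of derivatives
of Riemann's ξ-function on the critical line*, J. Number Theory 16 (1983) 49–74): theorems only — no
definitions, no named facts.

Conrey's Lemma 2 (p. 52) reads: "Any zero of `ξ^{(m)}(s)` satisfies `0 < σ < 1`. If `N^{(m)}(T)`
denotes the number of zeros of `ξ^{(m)}(s)` with `0 < t < T`, then
`N^{(m)}(T) = (T/2π) log(T/2π) − T/2π + O_m(log T)`", with the proof "by the argument principle and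
parts (a), (b), and (c) of Lemma 1 … similar to Backlund's proof of the assertion in the case `m = 0`
(see Titchmarsh §9.3)". The first sentence for `m = 1` is the tree's `Conrey1983_lemma2_xiDeriv_strip`
(`XiDerivativeZerosCounting.lean`). This file proves the second sentence for `m = 1` in the form
**`N^{(1)}(T) − N(T) = O(log T)`** (`N^{(1)} = xiDerivZeroCount 1`, `N = zetaZeroCount`, both with
multiplicity), from which Conrey's printed form follows by the tree's Riemann–von Mangoldt theorem for
`N(T)` (`riemann_von_mangoldt_holds`, `ZetaArgVariation.lean`).

## The argument (Backlund's, run for `ξ′` and `ξ` simultaneously)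

Write `F = ξ′/ξ`, `F₁ = ξ″/ξ′`. Both satisfy `F(1 − s) = −F(s)`, `F(s̄) = conj F(s)` (from
`ξ(1−s) = ξ(s)`, `ξ′(1−s) = −ξ′(s)`, `ξ″(1−s) = ξ″(s)` and reality), so the argument principle for the
entire functions `ξ′`, `ξ` on `R = [−1,2] × [−T,T]` (tree: `integral_boundary_rect_logDeriv`) folds
(tree: `rectBoundaryIntegral_eq_of_symmetric`) onto the quarter path `2 → 2+iT → ½+iT`:
`A₁ − B₁ = π N^{(1)}(T) + π/2` and `A − B = π N(T)`, where `A₁ = ∫₀ᵀ Re F₁(2+iy) dy`,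
`B₁ = Im ∫_{1/2}^{2} F₁(x+iT) dx` (similarly `A`, `B`), the `π/2` coming from the simple zero of `ξ′`
at `s = ½` (`ξ″(½) ≠ 0`, tree `ZetaScrewGrowth.deriv_deriv_riemannXi_one_half_ne_zero`); the zeros of `ξ′` in `R` are those with
`0 < Im s < T`, their conjugates, and `½`. Now `F₁ − F = g′/g` with `g = ξ′/ξ`:

* vertical edge: `Re g(2+iy) > 0` for all `y` (Lagarias' positivity `Re ξ′/ξ > 0` on `Re s ≥ 1`,
  tree `Lagarias1999Eq14.re_logDeriv_riemannXi_pos_of_one_le_re`), so `A₁ − A = arg g(2+iT) − arg g(2)`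
  has modulus `< π` (principal logarithm as a primitive, tree `integral_logDeriv_vertical`);
* horizontal edge: on `Re s > 0` one has `g = G + ζ′/ζ` with `G(s) = 1/s + 1/(s−1) + Γℝ′/Γℝ(s)` (tree
  `logDeriv_riemannXi_eq_add_logDeriv_riemannZeta`), i.e. `g = h/ζ` with the function
  `h = ζ′ + G ζ`, ANALYTIC on `Re s > 0`, `s ≠ 1`; hence `g′/g = h′/h − ζ′/ζ` and
  `B₁ − B = Im ∫_{1/2}^{2} h′/h − Im ∫_{1/2}^{2} ζ′/ζ`. The `ζ`-term is `O(log T)` by the tree's Backlund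
  estimate `abs_im_integral_logDeriv_riemannZeta_horizontal_le`; the `h`-term by Backlund's lemma
  (tree `abs_im_integral_logDeriv_le_backlund`) on the discs `|s − (2+iT)| ≤ 3/2 < 7/4`, where
  `|h| ≤ |ζ′| + |G||ζ| ≤ M(T) = O(T log T)` (`|ζ| ≤ 40(T+4)` on the Jensen disc, `ZetaZerosJensen.lean`;
  `|ζ′| ≤ 200(T+4)` by Cauchy's estimate on circles of radius `1/5`; `|Γℝ′/Γℝ| ≤ log(T+6)/2 + 5` from
  `‖ψ(w)‖ ≤ log(1+‖w‖) + 8`, `DigammaLogBound.lean`), and `|h(2+iT)| = |ζ(2+iT)| |F(2+iT)| ≥ 1/3`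
  for `T ≥ T₀`, because `Re F(2+iT) ≥ ½ log(T/2) − O(1) ≥ 1` (digamma lower bound
  `abs_re_digamma_sub_log_norm_le` and `|ζ′/ζ(2+iT)| ≤ Σ Λ(n)/n²`).

Altogether `|N^{(1)}(T) − N(T)| ≤ C log T` for `T ≥ T₀` off the ordinates of the zeros of `ξ` and `ξ′`,
and for all `T ≥ T₀` by shifting `T` slightly upwards past no ordinate (both zero sets are locally
finite and both counting functions are right-continuous step functions).

## Main results

* `XiDerivArg.quarter_path_eq_xiDeriv` — `A₁ − B₁ = π N^{(1)}(T) + π/2` (`T > 0` not an ordinate of a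
  zero of `ξ′`); `XiDerivArg.quarter_path_eq_xi` — `A − B = π N(T)`.
* `XiDerivArg.abs_xiDerivZeroCount_sub_zetaZeroCount_le_of_not_ordinate` — the explicit bound off the
  ordinates; `exists_abs_xiDerivZeroCount_sub_zetaZeroCount_le_log` — **`∃ C T₀, ∀ T ≥ T₀,
  |N^{(1)}(T) − N(T)| ≤ C log T`**.
* `xiDerivZeroCount_one_riemann_von_mangoldt` — Conrey's printed form
  `N^{(1)}(T) = (T/2π) log(T/2π) − T/2π + O(log T)`.
* `tendsto_xiDerivZeroCount_div_zetaZeroCount` — `N^{(1)}(T)/N(T) → 1`.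

Status: Conrey 1983 is a refereed paper; Lemma 2 is classical (Backlund 1918 for `m = 0`; Levinson–
Montgomery 1974 for `ζ^{(k)}`). No preprint is involved in this file. Nothing here bears on the truth of RH.

## References

* J. B. Conrey, J. Number Theory 16 (1983) 49–74: Lemma 1 (p. 51), Lemma 2 (p. 52). [key `Conrey1983`]
* E. C. Titchmarsh, *The Theory of the Riemann Zeta-Function*, 2nd ed. (1986), §9.3–9.4 (Backlund's
  proof of the Riemann–von Mangoldt formula; Thm. 9.4). [key `Titchmarsh1986`]
* N. Levinson, H. L. Montgomery, *Zeros of the derivatives of the Riemann zeta-function*, Acta Math. 133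
  (1974) 49–65, §2 (the same contour argument for `ζ′`). [key `LevinsonMontgomery1974`]
-/

noncomputable section

open Complex Filter Set MeasureTheory Metric
open scoped Real Topology ComplexConjugate

namespace Literature.NumberTheory.LFunctions

namespace XiDerivArg

/-! ## §1. `ξ′`, `ξ″` and the logarithmic derivative `F₁ = ξ″/ξ′`: analyticity and symmetries -/

/-- `ξ″` is analytic everywhere. [cite: Conrey1983, Lemma 2 proof (p. 52)] -/
theorem analyticOnNhd_deriv_deriv_riemannXi : AnalyticOnNhd ℂ (deriv (deriv riemannXi)) univ :=
  XiDerivCount.analyticOnNhd_deriv_riemannXi.deriv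

/-- `ξ″(1 − s) = ξ″(s)` (differentiate `ξ′(1 − s) = −ξ′(s)`).
[cite: Conrey1983, Lemma 2 proof (p. 52): ξ^{(m)}(s) = (−1)^m ξ^{(m)}(1 − s)] -/
theorem deriv_deriv_riemannXi_one_sub (s : ℂ) :
    deriv (deriv riemannXi) (1 - s) = deriv (deriv riemannXi) s := by
  have hfun : (fun z ↦ deriv riemannXi (1 - z)) = fun z ↦ -deriv riemannXi z :=
    funext deriv_riemannXi_one_sub
  have hd : HasDerivAt (fun z ↦ deriv riemannXi (1 - z))
      (deriv (deriv riemannXi) (1 - s) * (-1)) s := by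
    have h1 : HasDerivAt (fun z : ℂ ↦ 1 - z) (-1) s := (hasDerivAt_id' s).const_sub 1
    exact (differentiable_deriv_riemannXi (1 - s)).hasDerivAt.comp s h1
  rw [hfun] at hd
  have h2 : HasDerivAt (fun z ↦ -deriv riemannXi z) (-deriv (deriv riemannXi) s) s :=
    (differentiable_deriv_riemannXi s).hasDerivAt.neg
  have := hd.unique h2
  linear_combination -this

/-- `ξ″(s̄) = conj ξ″(s)`. [cite: Conrey1983, Lemma 2 proof (p. 52)] -/
theorem deriv_deriv_riemannXi_conj (s : ℂ) :
    deriv (deriv riemannXi) (conj s) = conj (deriv (deriv riemannXi) s) := by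
  have hfun : (conj ∘ deriv riemannXi ∘ conj : ℂ → ℂ) = deriv riemannXi := by
    funext z; simp [Function.comp_apply, deriv_riemannXi_conj z]
  have h : deriv (conj ∘ deriv riemannXi ∘ conj : ℂ → ℂ) = conj ∘ deriv (deriv riemannXi) ∘ conj :=
    deriv_conj_conj
  rw [hfun] at h
  have h' := congrFun h (conj s)
  simpa using h'

/-- `F₁(1 − s) = −F₁(s)` for `F₁ = ξ″/ξ′`. [cite: Conrey1983, Lemma 2 proof (p. 52)] -/
theorem logDeriv_deriv_riemannXi_one_sub (s : ℂ) :
    deriv (deriv riemannXi) (1 - s) / deriv riemannXi (1 - s) =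
      -(deriv (deriv riemannXi) s / deriv riemannXi s) := by
  rw [deriv_deriv_riemannXi_one_sub, deriv_riemannXi_one_sub, div_neg]

/-- `F₁(s̄) = conj F₁(s)` for `F₁ = ξ″/ξ′`. [cite: Conrey1983, Lemma 2 proof (p. 52)] -/
theorem logDeriv_deriv_riemannXi_conj (s : ℂ) :
    deriv (deriv riemannXi) (conj s) / deriv riemannXi (conj s) =
      conj (deriv (deriv riemannXi) s / deriv riemannXi s) := by
  rw [deriv_deriv_riemannXi_conj, deriv_riemannXi_conj, map_div₀]

/-- `F₁ = ξ″/ξ′` is continuous wherever `ξ′ ≠ 0`. [cite: Conrey1983, Lemma 2 proof (p. 52)] -/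
theorem continuousAt_logDeriv_deriv_riemannXi {s : ℂ} (hs : deriv riemannXi s ≠ 0) :
    ContinuousAt (fun z ↦ deriv (deriv riemannXi) z / deriv riemannXi z) s :=
  (analyticOnNhd_deriv_deriv_riemannXi s trivial).continuousAt.div
    (differentiable_deriv_riemannXi s).continuousAt hs

/-- If no zero of `ξ′` has ordinate `T`, then `ξ′ ≠ 0` on the lines `Im s = ±T`.
[cite: Conrey1983, Lemma 2 proof (p. 52)] -/
theorem deriv_riemannXi_ne_zero_of_im_eq {T : ℝ}
    (hT' : ∀ ρ : ℂ, deriv riemannXi ρ = 0 → ρ.im ≠ T) {s : ℂ} (hs : s.im = T ∨ s.im = -T) :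
    deriv riemannXi s ≠ 0 := by
  intro h0
  rcases hs with hs | hs
  · exact hT' s h0 hs
  · refine hT' (conj s) (by rw [deriv_riemannXi_conj, h0, map_zero]) ?_
    rw [conj_im, hs, neg_neg]

/-! ## §2. The zeros of `ξ′` in `(−1, 2) × (−T, T)` and their multiplicities -/

/-- The multiplicity of the zero of `ξ′` at `s = ½` is exactly `1` (`ξ′(½) = 0` by the functional equation,
`ξ″(½) ≠ 0` — tree `ZetaScrewGrowth.deriv_deriv_riemannXi_one_half_ne_zero`). [cite: Conrey1983, §1 (p. 49)] -/
theorem analyticOrderAt_deriv_riemannXi_half : analyticOrderAt (deriv riemannXi) (1 / 2) = 1 := by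
  have ha : AnalyticAt ℂ (deriv riemannXi) (1 / 2) :=
    XiDerivCount.analyticOnNhd_deriv_riemannXi _ trivial
  obtain ⟨n, hn⟩ := ENat.ne_top_iff_exists.mp (XiDerivCount.analyticOrderAt_deriv_riemannXi_ne_top (1 / 2))
  have h0 : deriv riemannXi (1 / 2) = 0 := by
    have := XiDerivCount.deriv_riemannXi_ofReal_eq_zero_iff.2 (rfl : (1 / 2 : ℝ) = 1 / 2)
    simpa using this
  have h1 : ((1 : ℕ) : ℕ∞) ≤ analyticOrderAt (deriv riemannXi) (1 / 2) := by
    rw [natCast_le_analyticOrderAt_iff_iteratedDeriv_eq_zero ha]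
    intro i hi
    interval_cases i
    simpa using h0
  have h2 : ¬ ((2 : ℕ) : ℕ∞) ≤ analyticOrderAt (deriv riemannXi) (1 / 2) := by
    rw [natCast_le_analyticOrderAt_iff_iteratedDeriv_eq_zero ha]
    intro h
    have := h 1 (by norm_num)
    rw [iteratedDeriv_one] at this
    exact ZetaScrewGrowth.deriv_deriv_riemannXi_one_half_ne_zero this
  rw [← hn] at h1 h2 ⊢
  have h1' : 1 ≤ n := by exact_mod_cast h1
  have h2' : ¬ (2 ≤ n) := fun h ↦ h2 (by exact_mod_cast h)
  have : n = 1 := by omega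
  rw [this]; rfl

/-- The multiplicities of `ξ′` are symmetric under conjugation: `ord_{s̄} ξ′ = ord_s ξ′`.
[cite: Conrey1983, Lemma 2 proof (p. 52)] -/
theorem analyticOrderAt_deriv_riemannXi_conj (s : ℂ) :
    analyticOrderAt (deriv riemannXi) (conj s) = analyticOrderAt (deriv riemannXi) s := by
  have ha : AnalyticAt ℂ (deriv riemannXi) (conj s) :=
    XiDerivCount.analyticOnNhd_deriv_riemannXi _ trivial
  rw [← analyticOrderAt_conj_conj ha]
  congr 1
  funext z
  rw [deriv_riemannXi_conj, conj_conj]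

/-- For an analytic point, `(meromorphicOrderAt ξ′ s).untop₀ = (analyticOrderAt ξ′ s).toNat` (as complex
numbers): the multiplicity in the argument principle is the one counted by `xiDerivZeroCount`.
[cite: Conrey1983, Lemma 2 proof (p. 52)] -/
theorem untop₀_meromorphicOrderAt_deriv_riemannXi (s : ℂ) :
    ((meromorphicOrderAt (deriv riemannXi) s).untop₀ : ℂ) =
      ((analyticOrderAt (deriv riemannXi) s).toNat : ℂ) := by
  have ha : AnalyticAt ℂ (deriv riemannXi) s := XiDerivCount.analyticOnNhd_deriv_riemannXi _ trivial
  obtain ⟨n, hn⟩ := ENat.ne_top_iff_exists.mp (XiDerivCount.analyticOrderAt_deriv_riemannXi_ne_top s)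
  rw [ha.meromorphicOrderAt_eq, ← hn, ENat.map_coe, WithTop.untop₀_coe, ENat.toNat_coe]
  norm_cast

/-- **The zeros of `ξ′` in the open rectangle `(−1, 2) × (−T, T)`**, for `T > 0` not an ordinate of a
zero of `ξ′`: the zeros with `0 < Im s ≤ T` (`xiDerivZeroBox 1 T`), their conjugates, and the real zero
`s = ½` (all zeros of `ξ′` have `0 < Re s < 1`, and the only real one is `½`).
[cite: Conrey1983, Lemma 2 (p. 52)] -/
theorem setOf_deriv_riemannXi_eq_zero_eq_union {T : ℝ} (hT : 0 < T)
    (hT' : ∀ ρ : ℂ, deriv riemannXi ρ = 0 → ρ.im ≠ T) :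
    {ρ : ℂ | deriv riemannXi ρ = 0 ∧ ρ ∈ Ioo (-1 : ℝ) 2 ×ℂ Ioo (-T) T} =
      (xiDerivZeroBox 1 T ∪ conj '' xiDerivZeroBox 1 T) ∪ {1 / 2} := by
  ext ρ
  simp only [mem_setOf_eq, mem_reProdIm, mem_Ioo, mem_union, mem_image, mem_singleton_iff,
    xiDerivZeroBox, iteratedDeriv_one]
  constructor
  · rintro ⟨h0, ⟨-, -⟩, him1, him2⟩
    rcases lt_trichotomy ρ.im 0 with hneg | hzero | hpos
    · left; right
      refine ⟨conj ρ, ⟨by rw [deriv_riemannXi_conj, h0, map_zero], ?_, ?_⟩, conj_conj ρ⟩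
      · rw [conj_im]; linarith
      · rw [conj_im]
        have : (conj ρ).im ≠ T := hT' (conj ρ) (by rw [deriv_riemannXi_conj, h0, map_zero])
        rw [conj_im] at this
        exact le_of_lt (lt_of_le_of_ne (by linarith) this)
    · right
      have hρ : ρ = (ρ.re : ℂ) := by
        apply Complex.ext <;> simp [hzero]
      rw [hρ] at h0
      have hre := XiDerivCount.deriv_riemannXi_ofReal_eq_zero_iff.1 h0
      rw [hρ, hre]
      push_cast; ring
    · left; left
      exact ⟨h0, hpos, le_of_lt (lt_of_le_of_ne him2.le (hT' ρ h0))⟩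
  · rintro ((⟨h0, h1, h2⟩ | ⟨w, ⟨h0, h1, h2⟩, rfl⟩) | h)
    · have hst := Conrey1983_lemma2_xiDeriv_strip ρ h0
      exact ⟨h0, ⟨by linarith [hst.1], by linarith [hst.2]⟩, by linarith,
        lt_of_le_of_ne h2 (hT' ρ h0)⟩
    · have hst := Conrey1983_lemma2_xiDeriv_strip w h0
      have h0' : deriv riemannXi (conj w) = 0 := by rw [deriv_riemannXi_conj, h0, map_zero]
      refine ⟨h0', ⟨?_, ?_⟩, ?_, ?_⟩
      · rw [conj_re]; linarith [hst.1]
      · rw [conj_re]; linarith [hst.2]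
      · rw [conj_im]; have := lt_of_le_of_ne h2 (hT' w h0); linarith
      · rw [conj_im]; linarith
    · subst h
      refine ⟨?_, ⟨by norm_num, by norm_num⟩, by simp [hT], by simp [hT]⟩
      have := XiDerivCount.deriv_riemannXi_ofReal_eq_zero_iff.2 (rfl : (1 / 2 : ℝ) = 1 / 2)
      simpa using this

/-- `(xiDerivZeroCount 1 T : ℂ)` is the `finsum` of the multiplicities over the box.
[cite: Conrey1983, Lemma 2 (p. 52)] -/
theorem xiDerivZeroCount_one_eq_finsum (T : ℝ) :
    (xiDerivZeroCount 1 T : ℂ) =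
      ∑ᶠ s ∈ xiDerivZeroBox 1 T, ((analyticOrderAt (deriv riemannXi) s).toNat : ℂ) := by
  unfold xiDerivZeroCount
  rw [iteratedDeriv_one]
  have h := (AddMonoidHom.map_finsum_mem (fun s ↦ (analyticOrderAt (deriv riemannXi) s).toNat)
    (Nat.castAddMonoidHom ℂ) (xiDerivZeroBox_one_finite T)).symm
  simpa using h.symm

/-- **The zeros of `ξ′` in `(−1, 2) × (−T, T)` number `2 N^{(1)}(T) + 1`** (with multiplicity), for
`T > 0` not an ordinate of a zero of `ξ′`. [cite: Conrey1983, Lemma 2 (p. 52)] -/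
theorem finsum_order_deriv_riemannXi_eq {T : ℝ} (hT : 0 < T)
    (hT' : ∀ ρ : ℂ, deriv riemannXi ρ = 0 → ρ.im ≠ T) :
    ∑ᶠ ρ ∈ {ρ : ℂ | deriv riemannXi ρ = 0 ∧ ρ ∈ Ioo (-1 : ℝ) 2 ×ℂ Ioo (-T) T},
        ((meromorphicOrderAt (deriv riemannXi) ρ).untop₀ : ℂ) = 2 * (xiDerivZeroCount 1 T : ℂ) + 1 := by
  rw [setOf_deriv_riemannXi_eq_zero_eq_union hT hT']
  have hfin : (xiDerivZeroBox 1 T).Finite := xiDerivZeroBox_one_finite T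
  have hdisj : Disjoint (xiDerivZeroBox 1 T) (conj '' xiDerivZeroBox 1 T) := by
    rw [Set.disjoint_left]
    rintro ρ ⟨-, h2, -⟩ ⟨w, ⟨-, hw2, -⟩, rfl⟩
    rw [conj_im] at h2
    linarith
  have hdisj' : Disjoint (xiDerivZeroBox 1 T ∪ conj '' xiDerivZeroBox 1 T) {1 / 2} := by
    rw [Set.disjoint_singleton_right]
    rintro (⟨-, h2, -⟩ | ⟨w, ⟨-, hw2, -⟩, hw⟩)
    · norm_num at h2
    · have := congrArg Complex.im hw
      rw [conj_im] at this
      norm_num at this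
      linarith
  rw [finsum_mem_union hdisj' (hfin.union (hfin.image _)) (Set.finite_singleton _),
    finsum_mem_union hdisj hfin (hfin.image _),
    finsum_mem_image (starRingEnd ℂ).injective.injOn, finsum_mem_singleton]
  simp_rw [untop₀_meromorphicOrderAt_deriv_riemannXi, analyticOrderAt_deriv_riemannXi_conj,
    analyticOrderAt_deriv_riemannXi_half]
  rw [← xiDerivZeroCount_one_eq_finsum]
  norm_num
  ring

/-! ## §3. The quarter-path identities for `ξ′` and for `ξ` -/

/-- **Argument principle for `ξ′`, folded onto `2 → 2+iT → ½+iT`**: for `T > 0` not an ordinate of a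
zero of `ξ′`, with `F₁ = ξ″/ξ′`,
`∫₀ᵀ Re F₁(2+iy) dy − Im ∫_{1/2}^{2} F₁(x+iT) dx = π N^{(1)}(T) + π/2`.
[cite: Conrey1983, Lemma 2 (p. 52)] -/
theorem quarter_path_eq_xiDeriv {T : ℝ} (hT : 0 < T)
    (hT' : ∀ ρ : ℂ, deriv riemannXi ρ = 0 → ρ.im ≠ T) :
    (∫ y in (0 : ℝ)..T, (deriv (deriv riemannXi) (2 + y * I) / deriv riemannXi (2 + y * I)).re) -
      (∫ x in (1 / 2 : ℝ)..2, deriv (deriv riemannXi) (x + T * I) / deriv riemannXi (x + T * I)).im =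
      π * xiDerivZeroCount 1 T + π / 2 := by
  set F₁ : ℂ → ℂ := fun z ↦ deriv (deriv riemannXi) z / deriv riemannXi z with hF₁
  have hAP := Literature.Analysis.Complex.integral_boundary_rect_logDeriv (f := deriv riemannXi)
    (a := -1) (b := 2) (c := -T) (d := T) (by norm_num) (by linarith)
    (fun z _ ↦ XiDerivCount.analyticOnNhd_deriv_riemannXi z trivial)
    (fun x _ ↦ deriv_riemannXi_ne_zero_of_im_eq hT' (Or.inr (by simp)))
    (fun x _ ↦ deriv_riemannXi_ne_zero_of_im_eq hT' (Or.inl (by simp)))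
    (fun y _ ↦ deriv_riemannXi_ne_zero_of_re_nonpos (by simp))
    (fun y _ ↦ deriv_riemannXi_ne_zero_of_one_le_re (by simp))
  rw [finsum_order_deriv_riemannXi_eq hT hT'] at hAP
  have hAP' : Literature.Analysis.Complex.rectBoundaryIntegral F₁ (-1) 2 (-T) T =
      2 * Real.pi * I * (2 * (xiDerivZeroCount 1 T : ℂ) + 1) := by
    rw [Literature.Analysis.Complex.rectBoundaryIntegral_def]
    exact hAP
  have hfold := rectBoundaryIntegral_eq_of_symmetric (F := F₁) hT.le
    (fun s ↦ logDeriv_deriv_riemannXi_one_sub s) (fun s ↦ logDeriv_deriv_riemannXi_conj s)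
    (fun y _ ↦ continuousAt_logDeriv_deriv_riemannXi (deriv_riemannXi_ne_zero_of_one_le_re (by simp)))
    (fun x _ ↦ continuousAt_logDeriv_deriv_riemannXi
      (deriv_riemannXi_ne_zero_of_im_eq hT' (Or.inl (by simp))))
  rw [hfold] at hAP'
  set A : ℝ := ∫ y in (0 : ℝ)..T, (F₁ (2 + y * I)).re
  set B : ℂ := ∫ x in (1 / 2 : ℝ)..2, F₁ (x + T * I)
  have := congrArg Complex.im hAP'
  simp only [mul_im, mul_re, I_re, I_im, ofReal_re, ofReal_im, sub_re, sub_im, re_ofNat, im_ofNat,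
    natCast_re, natCast_im, add_re, add_im, one_re, one_im] at this
  simp at this
  linarith

/-- **Argument principle for `ξ`, folded** (the step of Titchmarsh's Thm. 9.3 inside the tree's
`pi_mul_zetaArgS_eq`, isolated): for `T > 0` not an ordinate of a zero of `ζ`, with `F = ξ′/ξ`,
`∫₀ᵀ Re F(2+iy) dy − Im ∫_{1/2}^{2} F(x+iT) dx = π N(T)`. [cite: Titchmarsh1986, Thm. 9.3] -/
theorem quarter_path_eq_xi {T : ℝ} (hT : 0 < T)
    (hT' : ∀ ρ : ℂ, riemannZeta ρ = 0 → ρ.im ≠ T) :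
    (∫ y in (0 : ℝ)..T, (deriv riemannXi (2 + y * I) / riemannXi (2 + y * I)).re) -
      (∫ x in (1 / 2 : ℝ)..2, deriv riemannXi (x + T * I) / riemannXi (x + T * I)).im =
      π * zetaZeroCount T := by
  set F : ℂ → ℂ := fun z ↦ deriv riemannXi z / riemannXi z with hF
  have hAP := Literature.Analysis.Complex.integral_boundary_rect_logDeriv (f := riemannXi) (a := -1)
    (b := 2) (c := -T) (d := T) (by norm_num) (by linarith) (analyticOnNhd_riemannXi _)
    (fun x _ ↦ riemannXi_ne_zero_of_im_eq hT' (Or.inr (by simp)))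
    (fun x _ ↦ riemannXi_ne_zero_of_im_eq hT' (Or.inl (by simp)))
    (fun y _ ↦ riemannXi_ne_zero_of_re_le_zero (by simp))
    (fun y _ ↦ riemannXi_ne_zero_of_one_le_re (by simp))
  rw [finsum_order_riemannXi_eq hT hT'] at hAP
  have hAP' : Literature.Analysis.Complex.rectBoundaryIntegral F (-1) 2 (-T) T =
      2 * Real.pi * I * (2 * (zetaZeroCount T : ℂ)) := by
    rw [Literature.Analysis.Complex.rectBoundaryIntegral_def]
    exact hAP
  have hfold := rectBoundaryIntegral_eq_of_symmetric (F := F) hT.le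
    (fun s ↦ logDeriv_riemannXi_one_sub s) (fun s ↦ logDeriv_riemannXi_conj s)
    (fun y _ ↦ continuousAt_logDeriv_riemannXi (riemannXi_ne_zero_of_one_le_re (by simp)))
    (fun x _ ↦ continuousAt_logDeriv_riemannXi (riemannXi_ne_zero_of_im_eq hT' (Or.inl (by simp))))
  rw [hfold] at hAP'
  set A : ℝ := ∫ y in (0 : ℝ)..T, (F (2 + y * I)).re
  set B : ℂ := ∫ x in (1 / 2 : ℝ)..2, F (x + T * I)
  have := congrArg Complex.im hAP'
  simp only [mul_im, mul_re, I_re, I_im, ofReal_re, ofReal_im, sub_re, sub_im, re_ofNat, im_ofNat,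
    natCast_re, natCast_im] at this
  simp at this
  linarith

/-! ## §4. The vertical edge: `F₁ − F = g′/g` with `Re g > 0` on `Re s = 2` -/

/-- Pointwise, `ξ″/ξ′ − ξ′/ξ = g′/g` for `g = ξ′/ξ`, wherever `ξ ξ′ ≠ 0`.
[cite: Conrey1983, Lemma 2 proof (p. 52)] -/
theorem logDeriv_deriv_sub_logDeriv_eq {z : ℂ} (h0 : riemannXi z ≠ 0) (h1 : deriv riemannXi z ≠ 0) :
    deriv (deriv riemannXi) z / deriv riemannXi z - deriv riemannXi z / riemannXi z =
      deriv (fun w ↦ deriv riemannXi w / riemannXi w) z / (deriv riemannXi z / riemannXi z) := by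
  have hd : deriv (fun w ↦ deriv riemannXi w / riemannXi w) z =
      (deriv (deriv riemannXi) z * riemannXi z - deriv riemannXi z * deriv riemannXi z) /
        riemannXi z ^ 2 :=
    deriv_div (differentiable_deriv_riemannXi z) (differentiable_riemannXi z) h0
  rw [hd]
  field_simp

/-- **The vertical edge contributes at most `π`**: with `F₁ = ξ″/ξ′`, `F = ξ′/ξ`,
`|∫₀ᵀ Re F₁(2+iy) dy − ∫₀ᵀ Re F(2+iy) dy| ≤ π`, because the difference is
`arg g(2+iT) − arg g(2)` for `g = ξ′/ξ`, and `Re g > 0` on `Re s = 2` (Lagarias' positivity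
`Re ξ′/ξ(s) > 0` for `Re s ≥ 1`). [cite: Conrey1983, Lemma 2 proof (p. 52)] -/
theorem abs_vertical_sub_le {T : ℝ} (hT : 0 ≤ T) :
    |(∫ y in (0 : ℝ)..T, (deriv (deriv riemannXi) (2 + y * I) / deriv riemannXi (2 + y * I)).re) -
      (∫ y in (0 : ℝ)..T, (deriv riemannXi (2 + y * I) / riemannXi (2 + y * I)).re)| ≤ π := by
  set g : ℂ → ℂ := fun w ↦ deriv riemannXi w / riemannXi w with hg
  set F₁ : ℂ → ℂ := fun w ↦ deriv (deriv riemannXi) w / deriv riemannXi w with hF₁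
  have hξ : ∀ y : ℝ, riemannXi (2 + y * I) ≠ 0 := fun y ↦ riemannXi_ne_zero_of_one_le_re (by simp)
  have hξ' : ∀ y : ℝ, deriv riemannXi (2 + y * I) ≠ 0 := fun y ↦
    deriv_riemannXi_ne_zero_of_one_le_re (by simp)
  have hre : ∀ y : ℝ, 0 < (g (2 + y * I)).re := fun y ↦ by
    have := Lagarias1999Eq14.re_logDeriv_riemannXi_pos_of_one_le_re (s := 2 + y * I) (by simp)
    rwa [logDeriv_apply] at this
  have hgan : ∀ y : ℝ, AnalyticAt ℂ g (2 + y * I) := fun y ↦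
    (XiDerivCount.analyticOnNhd_deriv_riemannXi _ trivial).div (analyticOnNhd_riemannXi univ _ trivial)
      (hξ y)
  -- the principal logarithm of `g` is a primitive of `g'/g` along the edge
  have han : ∀ y ∈ Icc 0 T, AnalyticAt ℂ g ((2 : ℝ) + y * I) := fun y _ ↦ by
    simpa using hgan y
  have hslit : ∀ y ∈ Icc 0 T, g ((2 : ℝ) + y * I) ∈ slitPlane := fun y _ ↦
    Or.inl (by simpa using hre y)
  have hlog := Literature.Analysis.Complex.integral_logDeriv_vertical (g := g) 2 hT han hslit
  simp only [ofReal_ofNat, ofReal_zero, zero_mul, add_zero] at hlog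
  -- integrability along the edge
  have hi1 : IntervalIntegrable (fun y : ℝ ↦ F₁ (2 + y * I)) volume 0 T := by
    have := Literature.Analysis.Complex.intervalIntegrable_of_continuousAt_vertical (F := F₁) 2 hT
      fun y _ ↦ continuousAt_logDeriv_deriv_riemannXi (by simpa using hξ' y)
    simpa using this
  have hi2 : IntervalIntegrable (fun y : ℝ ↦ g (2 + y * I)) volume 0 T := by
    have := Literature.Analysis.Complex.intervalIntegrable_of_continuousAt_vertical (F := g) 2 hT
      fun y _ ↦ continuousAt_logDeriv_riemannXi (by simpa using hξ y)
    simpa using this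
  have hre1 : (∫ y in (0 : ℝ)..T, (F₁ (2 + y * I)).re) = (∫ y in (0 : ℝ)..T, F₁ (2 + y * I)).re := by
    have := ContinuousLinearMap.intervalIntegral_comp_comm (𝕜 := ℝ) reCLM hi1
    simpa using this
  have hre2 : (∫ y in (0 : ℝ)..T, (g (2 + y * I)).re) = (∫ y in (0 : ℝ)..T, g (2 + y * I)).re := by
    have := ContinuousLinearMap.intervalIntegral_comp_comm (𝕜 := ℝ) reCLM hi2
    simpa using this
  have hsub : (∫ y in (0 : ℝ)..T, F₁ (2 + y * I)) - (∫ y in (0 : ℝ)..T, g (2 + y * I)) =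
      ∫ y in (0 : ℝ)..T, deriv g (2 + y * I) / g (2 + y * I) := by
    rw [← intervalIntegral.integral_sub hi1 hi2]
    refine intervalIntegral.integral_congr fun y _ ↦ ?_
    exact logDeriv_deriv_sub_logDeriv_eq (hξ y) (hξ' y)
  have key : (∫ y in (0 : ℝ)..T, (F₁ (2 + y * I)).re) - (∫ y in (0 : ℝ)..T, (g (2 + y * I)).re) =
      (Complex.log (g (2 + T * I)) - Complex.log (g 2)).im := by
    rw [hre1, hre2, ← sub_re, hsub, ← hlog]
    simp
  show |(∫ y in (0 : ℝ)..T, (F₁ (2 + y * I)).re) - (∫ y in (0 : ℝ)..T, (g (2 + y * I)).re)| ≤ π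
  rw [key, sub_im, log_im, log_im]
  have a1 := abs_arg_le_pi_div_two_iff.2 (hre T).le
  have a2 := abs_arg_le_pi_div_two_iff.2 (hre 0).le
  simp only [ofReal_zero, zero_mul, add_zero] at a2
  have := abs_sub (arg (g (2 + T * I))) (arg (g 2))
  linarith

/-! ## §5. The horizontal edge: `g = h/ζ` with `h = ζ′ + G ζ` analytic, and Backlund's lemma for `h` -/

/-- **`ξ′/ξ = h/ζ` on `Re s > 0`**: for `Re z > 0`, `z ≠ 1`, `ζ(z) ≠ 0`,
`h(z) := ζ′(z) + G(z) ζ(z) = ζ(z) · ξ′/ξ(z)` with `G(z) = 1/z + 1/(z−1) + Γℝ′/Γℝ(z)`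
(tree: `ξ′/ξ = 1/s + 1/(s−1) + Γℝ′/Γℝ + ζ′/ζ`). [cite: Titchmarsh1986, §9.3] -/
theorem h_eq_zeta_mul_logDeriv {z : ℂ} (hz : 0 < z.re) (hz1 : z ≠ 1) (hζ : riemannZeta z ≠ 0) :
    deriv riemannZeta z + (z⁻¹ + (z - 1)⁻¹ + logDeriv Gammaℝ z) * riemannZeta z =
      riemannZeta z * (deriv riemannXi z / riemannXi z) := by
  rw [logDeriv_riemannXi_eq_add_logDeriv_riemannZeta hz hz1 hζ]
  field_simp
  ring

/-- `h` is analytic at every `z` with `Re z > 0`, `z ≠ 1`. [cite: Titchmarsh1986, §9.3] -/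
theorem analyticAt_h {z : ℂ} (hz : 0 < z.re) (hz1 : z ≠ 1) :
    AnalyticAt ℂ (fun w ↦ deriv riemannZeta w + (w⁻¹ + (w - 1)⁻¹ + logDeriv Gammaℝ w) * riemannZeta w)
      z := by
  have hζ : AnalyticAt ℂ riemannZeta z := analyticOn_riemannZeta z hz1
  have hz0 : z ≠ 0 := fun h ↦ by rw [h, zero_re] at hz; exact lt_irrefl _ hz
  have hG : AnalyticAt ℂ (fun w : ℂ ↦ w⁻¹ + (w - 1)⁻¹ + logDeriv Gammaℝ w) z :=
    ((analyticAt_id.inv hz0).add ((analyticAt_id.sub analyticAt_const).inv (sub_ne_zero.2 hz1))).add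
      (analyticAt_logDeriv_Gammaℝ hz)
  exact hζ.deriv.add (hG.mul hζ)

/-- **`g′/g = h′/h − ζ′/ζ` on the top edge**: for `Re z > 0`, `z ≠ 1`, `ζ(z) ≠ 0`, `ξ′(z) ≠ 0`,
`ξ″/ξ′(z) − ξ′/ξ(z) = h′/h(z) − ζ′/ζ(z)` (`g = ξ′/ξ` agrees with `h/ζ` near `z`).
[cite: Conrey1983, Lemma 2 proof (p. 52)] -/
theorem logDeriv_deriv_sub_logDeriv_eq_h {z : ℂ} (hz : 0 < z.re) (hz1 : z ≠ 1)
    (hζ : riemannZeta z ≠ 0) (hξ' : deriv riemannXi z ≠ 0) :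
    deriv (deriv riemannXi) z / deriv riemannXi z - deriv riemannXi z / riemannXi z =
      deriv (fun w ↦ deriv riemannZeta w + (w⁻¹ + (w - 1)⁻¹ + logDeriv Gammaℝ w) * riemannZeta w) z /
          (fun w ↦ deriv riemannZeta w + (w⁻¹ + (w - 1)⁻¹ + logDeriv Gammaℝ w) * riemannZeta w) z -
        deriv riemannZeta z / riemannZeta z := by
  set h : ℂ → ℂ := fun w ↦ deriv riemannZeta w + (w⁻¹ + (w - 1)⁻¹ + logDeriv Gammaℝ w) *
    riemannZeta w with hh
  set g : ℂ → ℂ := fun w ↦ deriv riemannXi w / riemannXi w with hg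
  have hξ : riemannXi z ≠ 0 := fun h0 ↦ hζ ((riemannXi_eq_zero_iff_holds z).1 h0).1
  -- `g = h/ζ` near `z`
  have hU : ∀ᶠ w in 𝓝 z, g w = h w / riemannZeta w := by
    have e1 : ∀ᶠ w in 𝓝 z, 0 < w.re := (isOpen_lt continuous_const continuous_re).mem_nhds hz
    have e2 : ∀ᶠ w in 𝓝 z, w ≠ 1 := eventually_ne_nhds hz1
    have e3 : ∀ᶠ w in 𝓝 z, riemannZeta w ≠ 0 :=
      (differentiableAt_riemannZeta hz1).continuousAt.eventually_ne hζ
    filter_upwards [e1, e2, e3] with w hw hw1 hwζ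
    simp only [hg, hh]
    rw [eq_div_iff hwζ, h_eq_zeta_mul_logDeriv hw hw1 hwζ]
    ring
  have hgz : g z = h z / riemannZeta z :=
    Filter.Eventually.self_of_nhds (p := fun w ↦ g w = h w / riemannZeta w) hU
  have hgz' : deriv g z = deriv (fun w ↦ h w / riemannZeta w) z :=
    Filter.EventuallyEq.deriv_eq hU
  have hh_an : AnalyticAt ℂ h z := analyticAt_h hz hz1
  have hζ_diff : DifferentiableAt ℂ riemannZeta z := differentiableAt_riemannZeta hz1
  have hdiv : deriv (fun w ↦ h w / riemannZeta w) z =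
      (deriv h z * riemannZeta z - h z * deriv riemannZeta z) / riemannZeta z ^ 2 :=
    deriv_div hh_an.differentiableAt hζ_diff hζ
  have hgne : g z ≠ 0 := div_ne_zero hξ' hξ
  have hhz : h z ≠ 0 := by
    intro h0
    rw [hgz, h0, zero_div] at hgne
    exact hgne rfl
  rw [logDeriv_deriv_sub_logDeriv_eq hξ hξ']
  show deriv g z / g z = deriv h z / h z - deriv riemannZeta z / riemannZeta z
  rw [hgz', hdiv, hgz]
  field_simp

/-- Points of the Backlund disc `|z − (2 + iT)| ≤ r`: `|Re z − 2| ≤ r` and `|Im z − T| ≤ r`. [folklore] -/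
private theorem mem_disc_bounds {T r : ℝ} {z : ℂ} (hz : z ∈ closedBall ((2 : ℂ) + T * I) r) :
    |z.re - 2| ≤ r ∧ |z.im - T| ≤ r := by
  rw [mem_closedBall, dist_eq_norm] at hz
  have h1 := abs_re_le_norm (z - (2 + T * I))
  have h2 := abs_im_le_norm (z - (2 + T * I))
  have e1 : (z - (2 + T * I)).re = z.re - 2 := by simp
  have e2 : (z - (2 + T * I)).im = z.im - T := by simp
  rw [e1] at h1
  rw [e2] at h2
  exact ⟨h1.trans hz, h2.trans hz⟩

/-- **`|Γℝ′/Γℝ(z)| ≤ log(T + 6)/2 + 6` on the disc `|z − (2+iT)| ≤ 7/4`, `T ≥ 4`** (from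
`Γℝ′/Γℝ(z) = −½ log π + ½ ψ(z/2)` and `‖ψ(w)‖ ≤ log(1 + ‖w‖) + 8` for `Re w > 0`, `|Im w| ≥ ½`).
[cite: Conrey1983, Lemma 1 (b) (p. 51)] -/
theorem norm_logDeriv_Gammaℝ_le_disc {T : ℝ} (hT : 4 ≤ T) {z : ℂ}
    (hz : z ∈ closedBall ((2 : ℂ) + T * I) (7 / 4)) :
    ‖logDeriv Gammaℝ z‖ ≤ Real.log (T + 6) / 2 + 6 := by
  obtain ⟨hre, him⟩ := mem_disc_bounds hz
  have hre' := abs_le.1 hre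
  have him' := abs_le.1 him
  have hzre : 0 < z.re := by linarith
  rw [Literature.NumberTheory.LFunctions.logDeriv_Gammaℝ (half_ne_neg_nat_of_re_pos' hzre),
    ← Complex.ofReal_log Real.pi_pos.le]
  set w : ℂ := z / 2 with hw
  have hwre' : w.re = z.re / 2 := by simp [hw]
  have hwim' : w.im = z.im / 2 := by simp [hw]
  have hwre : 0 < w.re := by rw [hwre']; linarith
  have hwim : 1 / 2 ≤ |w.im| := by
    rw [hwim', abs_of_nonneg (by linarith)]
    linarith
  have hψ := Literature.Analysis.SpecialFunctions.Complex.norm_digamma_le_log hwre hwim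
  have hwn : ‖w‖ ≤ (T + 6) / 2 := by
    have h1 : ‖z‖ ≤ |z.re| + |z.im| := Complex.norm_le_abs_re_add_abs_im z
    have h2 : ‖w‖ = ‖z‖ / 2 := by
      rw [hw, norm_div]
      norm_num
    have h3 : |z.re| ≤ 15 / 4 := by rw [abs_le]; constructor <;> linarith
    have h4 : |z.im| ≤ T + 7 / 4 := by rw [abs_le]; constructor <;> linarith
    rw [h2]; linarith
  have hlog : Real.log (1 + ‖w‖) ≤ Real.log (T + 6) :=
    Real.log_le_log (by positivity) (by linarith)
  have t1 : ‖(-(Real.log π : ℂ)) / 2‖ ≤ 2 := by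
    rw [norm_div, norm_neg, Complex.norm_real, Real.norm_eq_abs, Complex.norm_two,
      abs_of_pos (Real.log_pos (by linarith [Real.pi_gt_three]))]
    have : Real.log π ≤ π - 1 := Real.log_le_sub_one_of_pos Real.pi_pos
    linarith [Real.pi_lt_d2]
  have t2 : ‖Complex.digamma w / 2‖ ≤ (Real.log (1 + ‖w‖) + 8) / 2 := by
    rw [norm_div, Complex.norm_two]
    linarith
  calc ‖-(Real.log π : ℂ) / 2 + Complex.digamma w / 2‖
      ≤ ‖-(Real.log π : ℂ) / 2‖ + ‖Complex.digamma w / 2‖ := norm_add_le _ _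
    _ ≤ 2 + (Real.log (1 + ‖w‖) + 8) / 2 := add_le_add t1 t2
    _ ≤ Real.log (T + 6) / 2 + 6 := by linarith

/-- **`|ζ′(z)| ≤ 200 (T + 4)` on the disc `|z − (2+iT)| ≤ 7/4`, `T ≥ 2`**: Cauchy's estimate on the
circle of radius `1/5` about `z`, which lies in the Jensen disc `|w − (2+iT)| ≤ 39/20` where
`|ζ| ≤ 40(T + 4)` (`ZetaZerosJensen.lean`). [cite: Titchmarsh1986, Thm. 9.4] -/
theorem norm_deriv_riemannZeta_le_disc {T : ℝ} (hT : 2 ≤ T) {z : ℂ}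
    (hz : z ∈ closedBall ((2 : ℂ) + T * I) (7 / 4)) :
    ‖deriv riemannZeta z‖ ≤ 200 * (T + 4) := by
  have hT' : 2 ≤ |T| := by rwa [abs_of_nonneg (by linarith)]
  have hTabs : |T| = T := abs_of_nonneg (by linarith)
  have hsub : closedBall z (1 / 5) ⊆ closedBall ((2 : ℂ) + T * I) (39 / 20) := by
    intro w hw
    rw [mem_closedBall] at hw hz ⊢
    have := dist_triangle w z ((2 : ℂ) + T * I)
    linarith
  have hdiff : DifferentiableOn ℂ riemannZeta (closedBall ((2 : ℂ) + T * I) (39 / 20)) :=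
    fun w hw ↦ (analyticOnNhd_riemannZeta_jensenDisc hT' le_rfl w hw).differentiableAt.differentiableWithinAt
  have hdc : DiffContOnCl ℂ riemannZeta (ball z (1 / 5)) := hdiff.diffContOnCl_ball hsub
  have hC : ∀ w ∈ sphere z (1 / 5), ‖riemannZeta w‖ ≤ 40 * (T + 4) := by
    intro w hw
    have := norm_riemannZeta_le_of_mem_jensenDisc hT' (hsub (sphere_subset_closedBall hw))
    rwa [hTabs] at this
  have h := Complex.norm_deriv_le_of_forall_mem_sphere_norm_le (by norm_num : (0 : ℝ) < 1 / 5) hdc hC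
  have e : 40 * (T + 4) / (1 / 5 : ℝ) = 200 * (T + 4) := by ring
  linarith

/-- **`|h(z)| ≤ M(T) := 200(T+4) + 40(T+4)(7 + log(T+6)/2)` on the disc `|z − (2+iT)| ≤ 7/4`, `T ≥ 4`.**
[cite: Conrey1983, Lemma 2 proof (p. 52)] -/
theorem norm_h_le_disc {T : ℝ} (hT : 4 ≤ T) {z : ℂ} (hz : z ∈ closedBall ((2 : ℂ) + T * I) (7 / 4)) :
    ‖deriv riemannZeta z + (z⁻¹ + (z - 1)⁻¹ + logDeriv Gammaℝ z) * riemannZeta z‖ ≤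
      200 * (T + 4) + 40 * (T + 4) * (7 + Real.log (T + 6) / 2) := by
  have hT2 : 2 ≤ T := by linarith
  have hT' : 2 ≤ |T| := by rwa [abs_of_nonneg (by linarith)]
  have hTabs : |T| = T := abs_of_nonneg (by linarith)
  obtain ⟨hre, him⟩ := mem_disc_bounds hz
  have hre' := abs_le.1 hre
  have him' := abs_le.1 him
  have hzim : 9 / 4 ≤ z.im := by linarith
  have hζ : ‖riemannZeta z‖ ≤ 40 * (T + 4) := by
    have := norm_riemannZeta_le_of_mem_jensenDisc hT' (closedBall_subset_closedBall (by norm_num) hz)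
    rwa [hTabs] at this
  have hζ' := norm_deriv_riemannZeta_le_disc hT2 hz
  have hΓ := norm_logDeriv_Gammaℝ_le_disc hT hz
  have hzn : 9 / 4 ≤ ‖z‖ := hzim.trans ((le_abs_self _).trans (Complex.abs_im_le_norm z))
  have hinv1 : ‖z⁻¹‖ ≤ 1 / 2 := by
    rw [norm_inv]
    exact inv_le_of_inv_le₀ (by norm_num) (by norm_num; linarith)
  have hinv2 : ‖(z - 1)⁻¹‖ ≤ 1 / 2 := by
    rw [norm_inv]
    have h1 : (z - 1).im = z.im := by simp
    have hzn1 : 9 / 4 ≤ ‖z - 1‖ := by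
      have := (le_abs_self _).trans (Complex.abs_im_le_norm (z - 1))
      rw [h1] at this
      linarith
    exact inv_le_of_inv_le₀ (by norm_num) (by norm_num; linarith)
  have hG : ‖z⁻¹ + (z - 1)⁻¹ + logDeriv Gammaℝ z‖ ≤ 7 + Real.log (T + 6) / 2 := by
    calc ‖z⁻¹ + (z - 1)⁻¹ + logDeriv Gammaℝ z‖
        ≤ ‖z⁻¹‖ + ‖(z - 1)⁻¹‖ + ‖logDeriv Gammaℝ z‖ := norm_add₃_le
      _ ≤ 1 / 2 + 1 / 2 + (Real.log (T + 6) / 2 + 6) := by gcongr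
      _ = 7 + Real.log (T + 6) / 2 := by ring
  have hG0 : 0 ≤ 7 + Real.log (T + 6) / 2 := by
    have := Real.log_nonneg (show (1 : ℝ) ≤ T + 6 by linarith)
    linarith
  calc ‖deriv riemannZeta z + (z⁻¹ + (z - 1)⁻¹ + logDeriv Gammaℝ z) * riemannZeta z‖
      ≤ ‖deriv riemannZeta z‖ + ‖z⁻¹ + (z - 1)⁻¹ + logDeriv Gammaℝ z‖ * ‖riemannZeta z‖ := by
        rw [← norm_mul]; exact norm_add_le _ _
    _ ≤ 200 * (T + 4) + (7 + Real.log (T + 6) / 2) * (40 * (T + 4)) :=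
        add_le_add hζ' (mul_le_mul hG hζ (norm_nonneg _) hG0)
    _ = 200 * (T + 4) + 40 * (T + 4) * (7 + Real.log (T + 6) / 2) := by ring

open scoped LSeries.notation ArithmeticFunction.vonMangoldt in
/-- **`Re ξ′/ξ(2 + iT) ≥ 1` for `T ≥ T₁`**: `Re ξ′/ξ(2+iT) = Re(1/s + 1/(s−1)) + (−½ log π + ½ Re ψ(1 + iT/2))
+ Re ζ′/ζ(2+iT) ≥ ½ log(T/2) − 1.4 − Σ Λ(n)/n²` (digamma: `|Re ψ(w) − log‖w‖| ≤ 1/(2‖w‖²) + π/(4|Im w|)`;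
`|ζ′/ζ| ≤ Σ Λ(n) n⁻²` on `Re s = 2`). [cite: Conrey1983, Lemma 1 (b) (p. 51)] -/
theorem exists_re_logDeriv_riemannXi_two_add_ge :
    ∃ T₁ : ℝ, 4 ≤ T₁ ∧ ∀ T : ℝ, T₁ ≤ T →
      1 ≤ (deriv riemannXi (2 + T * I) / riemannXi (2 + T * I)).re := by
  set C : ℝ := ∑' n : ℕ, ‖LSeries.term ↗Λ (2 : ℂ) n‖ with hC
  have hC0 : 0 ≤ C := tsum_nonneg fun _ ↦ norm_nonneg _
  refine ⟨max 4 (2 * Real.exp (2 * (C + 2.4))), le_max_left _ _, fun T hT ↦ ?_⟩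
  have hT4 : 4 ≤ T := (le_max_left _ _).trans hT
  have hTexp : 2 * Real.exp (2 * (C + 2.4)) ≤ T := (le_max_right _ _).trans hT
  set s : ℂ := 2 + T * I with hs
  have hsre : s.re = 2 := by simp [hs]
  have hs1 : s ≠ 1 := fun h ↦ by have := congrArg Complex.re h; rw [hsre] at this; norm_num at this
  have hζ : riemannZeta s ≠ 0 := riemannZeta_two_add_ne_zero T
  rw [logDeriv_riemannXi_eq_add_logDeriv_riemannZeta (by rw [hsre]; norm_num) hs1 hζ]
  -- the four real parts
  have h1 : 0 ≤ (s⁻¹).re := by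
    rw [inv_re]; exact div_nonneg (by rw [hsre]; norm_num) (Complex.normSq_nonneg _)
  have h2 : 0 ≤ ((s - 1)⁻¹).re := by
    rw [inv_re]; exact div_nonneg (by norm_num [hs]) (Complex.normSq_nonneg _)
  have h3 : Real.log (T / 2) / 2 - 1.4 ≤ (logDeriv Gammaℝ s).re := by
    rw [Literature.NumberTheory.LFunctions.logDeriv_Gammaℝ (half_ne_neg_nat_of_re_pos' (by rw [hsre]; norm_num)),
      ← Complex.ofReal_log Real.pi_pos.le]
    set w : ℂ := s / 2 with hw
    have hwre : w.re = 1 := by norm_num [hw, hs]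
    have hwim : w.im = T / 2 := by norm_num [hw, hs]
    have hwn : T / 2 ≤ ‖w‖ := by
      have := Complex.abs_im_le_norm w
      rw [hwim, abs_of_nonneg (by linarith)] at this
      exact this
    have hψ := Literature.Analysis.SpecialFunctions.Complex.abs_re_digamma_sub_log_norm_le (w := w)
      (by rw [hwre]; norm_num) (by rw [hwim]; linarith)
    have hψ' := (abs_le.1 hψ).1
    have hw2 : 2 ≤ ‖w‖ := le_trans (by linarith) hwn
    have e1 : 1 / (2 * ‖w‖ ^ 2) ≤ 1 / 8 := by
      rw [div_le_div_iff₀ (by positivity) (by norm_num)]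
      nlinarith
    have e2 : π / (4 * |w.im|) ≤ 2 / 5 := by
      rw [hwim, abs_of_nonneg (by linarith), div_le_div_iff₀ (by positivity) (by norm_num)]
      nlinarith [Real.pi_lt_d2]
    have hlogw : Real.log (T / 2) ≤ Real.log ‖w‖ := Real.log_le_log (by linarith) hwn
    have hlogpi : Real.log π ≤ 2.2 := by
      have : Real.log π ≤ π - 1 := Real.log_le_sub_one_of_pos Real.pi_pos
      linarith [Real.pi_lt_d2]
    have hre : (-(Real.log π : ℂ) / 2 + Complex.digamma w / 2).re =
        -Real.log π / 2 + (Complex.digamma w).re / 2 := by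
      simp only [add_re, Complex.div_ofNat_re, neg_re, ofReal_re]
    rw [hre]
    linarith
  have hζζ : ‖deriv riemannZeta s / riemannZeta s‖ ≤ C := by
    have h := norm_logDeriv_riemannZeta_le_of_two_le_re (s := s) (by rw [hsre])
    rw [hsre] at h
    rw [hC]
    simpa using h
  have h4 : -C ≤ (deriv riemannZeta s / riemannZeta s).re := by
    have := (abs_le.1 ((abs_re_le_norm _).trans hζζ)).1
    linarith
  -- `log (T/2) ≥ 2 (C + 2.4)`
  have hlog : 2 * (C + 2.4) ≤ Real.log (T / 2) := by
    rw [Real.le_log_iff_exp_le (by linarith)]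
    linarith
  simp only [add_re]
  linarith

/-- **Backlund's lemma for `h` on the top edge**: for `T ≥ 4` with `Re ξ′/ξ(2+iT) ≥ 1`, and no zero of
`ζ` or `ξ′` on `[½, 2] × {T}`,
`|Im ∫_{1/2}^{2} h′/h(x+iT) dx| ≤ π (log(3 M(T))/log(7/6) + 1)` with `M(T)` as in `norm_h_le_disc`
(`|h(2+iT)| = |ζ(2+iT)| · |ξ′/ξ(2+iT)| ≥ 1/3`). [cite: Conrey1983, Lemma 2 proof (p. 52)] -/
theorem abs_im_integral_logDeriv_h_le {T : ℝ} (hT : 4 ≤ T)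
    (hF : 1 ≤ (deriv riemannXi (2 + T * I) / riemannXi (2 + T * I)).re)
    (hζT : ∀ x ∈ Icc (1 / 2 : ℝ) 2, riemannZeta (x + T * I) ≠ 0)
    (hξT : ∀ x ∈ Icc (1 / 2 : ℝ) 2, deriv riemannXi (x + T * I) ≠ 0) :
    |(∫ x in (1 / 2 : ℝ)..2,
        deriv (fun w ↦ deriv riemannZeta w + (w⁻¹ + (w - 1)⁻¹ + logDeriv Gammaℝ w) * riemannZeta w)
            (x + T * I) /
          (fun w ↦ deriv riemannZeta w + (w⁻¹ + (w - 1)⁻¹ + logDeriv Gammaℝ w) * riemannZeta w)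
            (x + T * I)).im| ≤
      π * (Real.log (3 * (200 * (T + 4) + 40 * (T + 4) * (7 + Real.log (T + 6) / 2))) /
        Real.log (7 / 6) + 1) := by
  set h : ℂ → ℂ := fun w ↦ deriv riemannZeta w + (w⁻¹ + (w - 1)⁻¹ + logDeriv Gammaℝ w) *
    riemannZeta w with hh
  set M : ℝ := 200 * (T + 4) + 40 * (T + 4) * (7 + Real.log (T + 6) / 2) with hM
  have hL0 : 0 ≤ Real.log (T + 6) := Real.log_nonneg (by linarith)
  have hM1 : 1 ≤ M := by rw [hM]; nlinarith
  -- hypotheses of Backlund's lemma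
  have hg : ∀ z ∈ closedBall (((2 : ℝ) : ℂ) + T * I) (7 / 4), AnalyticAt ℂ h z := by
    intro z hz
    simp only [ofReal_ofNat] at hz
    obtain ⟨hre, him⟩ := mem_disc_bounds hz
    have hre' := abs_le.1 hre
    have him' := abs_le.1 him
    refine analyticAt_h (by linarith) fun h1 ↦ ?_
    have := congrArg Complex.im h1
    simp at this
    linarith
  have hgM : ∀ z ∈ closedBall (((2 : ℝ) : ℂ) + T * I) (7 / 4), ‖h z‖ ≤ M := by
    intro z hz
    simp only [ofReal_ofNat] at hz
    exact norm_h_le_disc hT hz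
  have hcenter : h ((2 : ℝ) + T * I) = riemannZeta (2 + T * I) *
      (deriv riemannXi (2 + T * I) / riemannXi (2 + T * I)) := by
    simp only [ofReal_ofNat, hh]
    exact h_eq_zeta_mul_logDeriv (by simp) (fun h1 ↦ by
      have := congrArg Complex.re h1; norm_num at this) (riemannZeta_two_add_ne_zero T)
  have hnorm : 1 / 3 ≤ ‖h ((2 : ℝ) + T * I)‖ := by
    rw [hcenter, norm_mul]
    have h1 := one_third_le_norm_riemannZeta_two_add T
    have h2 : 1 ≤ ‖deriv riemannXi (2 + T * I) / riemannXi (2 + T * I)‖ :=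
      hF.trans (re_le_norm _)
    nlinarith [norm_nonneg (riemannZeta (2 + ↑T * I))]
  have hc : h ((2 : ℝ) + T * I) ≠ 0 := by
    intro h0; rw [h0, norm_zero] at hnorm; norm_num at hnorm
  have h0 : ∀ x ∈ Icc (1 / 2 : ℝ) 2, h (x + T * I) ≠ 0 := by
    intro x hx h0'
    have hx1 : (x : ℂ) + T * I ≠ 1 := fun h1 ↦ by
      have := congrArg Complex.im h1; simp at this; linarith
    have hre : 0 < ((x : ℂ) + T * I).re := by simp; linarith [hx.1]
    have e := h_eq_zeta_mul_logDeriv hre hx1 (hζT x hx)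
    simp only [hh] at h0'
    rw [h0'] at e
    have hξ : riemannXi (x + T * I) ≠ 0 := fun h0'' ↦
      hζT x hx ((riemannXi_eq_zero_iff_holds _).1 h0'').1
    rcases mul_eq_zero.1 e.symm with h' | h'
    · exact hζT x hx h'
    · exact div_ne_zero (hξT x hx) hξ h'
  have hB := Literature.Analysis.Complex.abs_im_integral_logDeriv_le_backlund (g := h) (c := 2) (y := T)
    (r := 3 / 2) (R := 7 / 4) (M := M) (a := 1 / 2) (b := 2) (by norm_num) (by norm_num) hM1 hg hgM hc
    (by norm_num) (by norm_num) (by norm_num) h0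
  refine hB.trans ?_
  have h76 : (7 : ℝ) / 4 / (3 / 2) = 7 / 6 := by norm_num
  rw [h76]
  have hlog76 : 0 < Real.log (7 / 6) := Real.log_pos (by norm_num)
  have hpos : 0 < ‖h ((2 : ℝ) + T * I)‖ := by linarith
  have h1 : Real.log (M / ‖h ((2 : ℝ) + T * I)‖) ≤ Real.log (3 * M) := by
    apply Real.log_le_log (div_pos (by linarith) hpos)
    rw [div_le_iff₀ hpos]
    nlinarith
  have := div_le_div_of_nonneg_right h1 hlog76.le
  nlinarith [Real.pi_pos]

/-- **The horizontal edge is `O(log T)`**: for `T ≥ 4` with `Re ξ′/ξ(2+iT) ≥ 1` and no zero of `ζ` or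
`ξ′` on `[½, 2] × {T}`, with `F₁ = ξ″/ξ′`, `F = ξ′/ξ`,
`|Im ∫_{1/2}^{2} F₁(x+iT) dx − Im ∫_{1/2}^{2} F(x+iT) dx| ≤ π (log(3M(T))/log(7/6) + 1) +
π (log(120(T+4))/log(7/6) + 1)`. [cite: Conrey1983, Lemma 2 proof (p. 52)] -/
theorem abs_horizontal_sub_le {T : ℝ} (hT : 4 ≤ T)
    (hF : 1 ≤ (deriv riemannXi (2 + T * I) / riemannXi (2 + T * I)).re)
    (hζT : ∀ x ∈ Icc (1 / 2 : ℝ) 2, riemannZeta (x + T * I) ≠ 0)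
    (hξT : ∀ x ∈ Icc (1 / 2 : ℝ) 2, deriv riemannXi (x + T * I) ≠ 0) :
    |(∫ x in (1 / 2 : ℝ)..2, deriv (deriv riemannXi) (x + T * I) / deriv riemannXi (x + T * I)).im -
      (∫ x in (1 / 2 : ℝ)..2, deriv riemannXi (x + T * I) / riemannXi (x + T * I)).im| ≤
      π * (Real.log (3 * (200 * (T + 4) + 40 * (T + 4) * (7 + Real.log (T + 6) / 2))) /
          Real.log (7 / 6) + 1) +
        π * (Real.log (120 * (T + 4)) / Real.log (7 / 6) + 1) := by
  set h : ℂ → ℂ := fun w ↦ deriv riemannZeta w + (w⁻¹ + (w - 1)⁻¹ + logDeriv Gammaℝ w) *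
    riemannZeta w with hh
  set F₁ : ℂ → ℂ := fun z ↦ deriv (deriv riemannXi) z / deriv riemannXi z with hF₁
  set F : ℂ → ℂ := fun z ↦ deriv riemannXi z / riemannXi z with hF'
  set Lh : ℂ → ℂ := fun z ↦ deriv h z / h z with hLh
  set Lζ : ℂ → ℂ := fun z ↦ deriv riemannZeta z / riemannZeta z with hLζ
  have hx1 : ∀ x : ℝ, (x : ℂ) + T * I ≠ 1 := fun x h1 ↦ by
    have := congrArg Complex.im h1; simp at this; linarith
  have hxre : ∀ x ∈ Icc (1 / 2 : ℝ) 2, 0 < ((x : ℂ) + T * I).re := fun x hx ↦ by simp; linarith [hx.1]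
  have hξ : ∀ x ∈ Icc (1 / 2 : ℝ) 2, riemannXi (x + T * I) ≠ 0 := fun x hx h0 ↦
    hζT x hx ((riemannXi_eq_zero_iff_holds _).1 h0).1
  -- pointwise identity on the segment
  have hpt : ∀ x ∈ Icc (1 / 2 : ℝ) 2, F₁ (x + T * I) - F (x + T * I) = Lh (x + T * I) - Lζ (x + T * I) :=
    fun x hx ↦ logDeriv_deriv_sub_logDeriv_eq_h (hxre x hx) (hx1 x) (hζT x hx) (hξT x hx)
  -- `h ≠ 0` along the segment
  have hh0 : ∀ x ∈ Icc (1 / 2 : ℝ) 2, h (x + T * I) ≠ 0 := by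
    intro x hx h0
    have e := h_eq_zeta_mul_logDeriv (hxre x hx) (hx1 x) (hζT x hx)
    simp only [hh] at h0
    rw [h0] at e
    rcases mul_eq_zero.1 e.symm with h' | h'
    · exact hζT x hx h'
    · exact div_ne_zero (hξT x hx) (hξ x hx) h'
  -- integrability
  have i1 : IntervalIntegrable (fun x : ℝ ↦ F₁ (x + T * I)) volume (1 / 2) 2 :=
    Literature.Analysis.Complex.intervalIntegrable_of_continuousAt_horizontal (F := F₁) T (by norm_num)
      fun x hx ↦ continuousAt_logDeriv_deriv_riemannXi (hξT x hx)
  have i2 : IntervalIntegrable (fun x : ℝ ↦ F (x + T * I)) volume (1 / 2) 2 :=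
    Literature.Analysis.Complex.intervalIntegrable_of_continuousAt_horizontal (F := F) T (by norm_num)
      fun x hx ↦ continuousAt_logDeriv_riemannXi (hξ x hx)
  have i3 : IntervalIntegrable (fun x : ℝ ↦ Lh (x + T * I)) volume (1 / 2) 2 :=
    Literature.Analysis.Complex.intervalIntegrable_of_continuousAt_horizontal (F := Lh) T (by norm_num)
      fun x hx ↦ by
        have ha := analyticAt_h (hxre x hx) (hx1 x)
        exact ha.deriv.continuousAt.div ha.continuousAt (hh0 x hx)
  have i4 : IntervalIntegrable (fun x : ℝ ↦ Lζ (x + T * I)) volume (1 / 2) 2 :=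
    Literature.Analysis.Complex.intervalIntegrable_of_continuousAt_horizontal (F := Lζ) T (by norm_num)
      fun x hx ↦ continuousAt_logDeriv_riemannZeta (hx1 x) (hζT x hx)
  have hint : (∫ x in (1 / 2 : ℝ)..2, F₁ (x + T * I)) - (∫ x in (1 / 2 : ℝ)..2, F (x + T * I)) =
      (∫ x in (1 / 2 : ℝ)..2, Lh (x + T * I)) - ∫ x in (1 / 2 : ℝ)..2, Lζ (x + T * I) := by
    rw [← intervalIntegral.integral_sub i1 i2, ← intervalIntegral.integral_sub i3 i4]
    refine intervalIntegral.integral_congr fun x hx ↦ ?_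
    rw [uIcc_of_le (by norm_num)] at hx
    exact hpt x hx
  have hB1 := abs_im_integral_logDeriv_h_le hT hF hζT hξT
  have hB2 := abs_im_integral_logDeriv_riemannZeta_horizontal_le (T := T) (by linarith) hζT
  have key : (∫ x in (1 / 2 : ℝ)..2, F₁ (x + T * I)).im - (∫ x in (1 / 2 : ℝ)..2, F (x + T * I)).im =
      (∫ x in (1 / 2 : ℝ)..2, Lh (x + T * I)).im - (∫ x in (1 / 2 : ℝ)..2, Lζ (x + T * I)).im := by
    rw [← sub_im, hint, sub_im]
  show |(∫ x in (1 / 2 : ℝ)..2, F₁ (x + T * I)).im - (∫ x in (1 / 2 : ℝ)..2, F (x + T * I)).im| ≤ _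
  rw [key]
  exact (abs_sub _ _).trans (add_le_add hB1 hB2)

/-! ## §6. `|N^{(1)}(T) − N(T)| ≪ log T` off the ordinates, and for all large `T` -/

/-- **Conrey's Lemma 2 (`m = 1`), explicit form off the ordinates.** For `T ≥ 4` with
`Re ξ′/ξ(2+iT) ≥ 1`, `T` not the ordinate of a zero of `ζ` nor of `ξ′`:
`|N^{(1)}(T) − N(T)| ≤ 4 + (log(3M(T)) + log(120(T+4)))/log(7/6)`, `M(T) = 200(T+4) + 40(T+4)(7 + log(T+6)/2)`.
[cite: Conrey1983, Lemma 2 (p. 52)] -/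
theorem abs_sub_le_of_not_ordinate {T : ℝ} (hT : 4 ≤ T)
    (hF : 1 ≤ (deriv riemannXi (2 + T * I) / riemannXi (2 + T * I)).re)
    (hζ : ∀ ρ : ℂ, riemannZeta ρ = 0 → ρ.im ≠ T) (hξ' : ∀ ρ : ℂ, deriv riemannXi ρ = 0 → ρ.im ≠ T) :
    |(xiDerivZeroCount 1 T : ℝ) - zetaZeroCount T| ≤
      4 + (Real.log (3 * (200 * (T + 4) + 40 * (T + 4) * (7 + Real.log (T + 6) / 2))) +
        Real.log (120 * (T + 4))) / Real.log (7 / 6) := by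
  have hT0 : 0 < T := by linarith
  have hq1 := quarter_path_eq_xiDeriv hT0 hξ'
  have hq := quarter_path_eq_xi hT0 hζ
  have hv := abs_vertical_sub_le hT0.le
  have hh := abs_horizontal_sub_le hT hF (fun x _ h0 ↦ hζ _ h0 (by simp))
    (fun x _ h0 ↦ hξ' _ h0 (by simp))
  set A₁ : ℝ := ∫ y in (0 : ℝ)..T, (deriv (deriv riemannXi) (2 + y * I) / deriv riemannXi (2 + y * I)).re
  set B₁ : ℝ := (∫ x in (1 / 2 : ℝ)..2,
    deriv (deriv riemannXi) (x + T * I) / deriv riemannXi (x + T * I)).im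
  set A : ℝ := ∫ y in (0 : ℝ)..T, (deriv riemannXi (2 + y * I) / riemannXi (2 + y * I)).re
  set B : ℝ := (∫ x in (1 / 2 : ℝ)..2, deriv riemannXi (x + T * I) / riemannXi (x + T * I)).im
  set L : ℝ := Real.log (3 * (200 * (T + 4) + 40 * (T + 4) * (7 + Real.log (T + 6) / 2)))
  set L' : ℝ := Real.log (120 * (T + 4))
  set l : ℝ := Real.log (7 / 6)
  have hπ := Real.pi_pos
  -- `π (N₁ − N) + π/2 = (A₁ − A) − (B₁ − B)`
  have hid : π * ((xiDerivZeroCount 1 T : ℝ) - zetaZeroCount T) = (A₁ - A) - (B₁ - B) - π / 2 := by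
    linarith
  have hv' := abs_le.1 hv
  have hh' := abs_le.1 hh
  rw [abs_le]
  constructor
  · have key : π * (-(4 + (L + L') / l)) ≤ π * ((xiDerivZeroCount 1 T : ℝ) - zetaZeroCount T) := by
      rw [hid]
      have e : π * (-(4 + (L + L') / l)) =
          -(4 * π) - (π * (L / l + 1) + π * (L' / l + 1)) + 2 * π := by ring
      rw [e]
      linarith
    exact le_of_mul_le_mul_left key hπ
  · have key : π * ((xiDerivZeroCount 1 T : ℝ) - zetaZeroCount T) ≤ π * (4 + (L + L') / l) := by
      rw [hid]
      have e : π * (4 + (L + L') / l) = 4 * π + (π * (L / l + 1) + π * (L' / l + 1)) - 2 * π := by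
        ring
      rw [e]
      linarith
    exact le_of_mul_le_mul_left key hπ

/-- The explicit bound is at most `100 + 25 log(T + 6)` for `T ≥ 4`. [folklore] -/
private theorem explicit_bound_le {T : ℝ} (hT : 4 ≤ T) :
    4 + (Real.log (3 * (200 * (T + 4) + 40 * (T + 4) * (7 + Real.log (T + 6) / 2))) +
        Real.log (120 * (T + 4))) / Real.log (7 / 6) ≤ 100 + 25 * Real.log (T + 6) := by
  set L6 : ℝ := Real.log (T + 6) with hL6
  have hL6₀ : 0 ≤ L6 := Real.log_nonneg (by linarith)
  have hL6' : L6 ≤ T + 5 := (Real.log_le_sub_one_of_pos (by linarith)).trans (by linarith)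
  -- `3 M(T) ≤ 204 (T+6)²`
  have hA : 3 * (200 * (T + 4) + 40 * (T + 4) * (7 + L6 / 2)) = (T + 4) * (1440 + 60 * L6) := by ring
  have hB : (T + 4) * (1440 + 60 * L6) ≤ (T + 6) * (1740 + 60 * T) :=
    mul_le_mul (by linarith) (by linarith) (by positivity) (by positivity)
  have hC : (T + 6) * (1740 + 60 * T) ≤ 204 * (T + 6) ^ 2 := by nlinarith
  have hMpos : 0 < 3 * (200 * (T + 4) + 40 * (T + 4) * (7 + L6 / 2)) := by rw [hA]; positivity
  have hM1 : 1 ≤ 3 * (200 * (T + 4) + 40 * (T + 4) * (7 + L6 / 2)) := by rw [hA]; nlinarith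
  have he1 : (2.7 : ℝ) < Real.exp 1 := lt_trans (by norm_num) Real.exp_one_gt_d9
  have h204 : Real.log 204 ≤ 6 := by
    rw [Real.log_le_iff_le_exp (by norm_num)]
    have h6 : Real.exp 6 = Real.exp 1 ^ 6 := by rw [← Real.exp_nat_mul]; norm_num
    rw [h6]
    have := pow_le_pow_left₀ (by norm_num) he1.le 6
    nlinarith
  have h120 : Real.log 120 ≤ 5 := by
    rw [Real.log_le_iff_le_exp (by norm_num)]
    have h5 : Real.exp 5 = Real.exp 1 ^ 5 := by rw [← Real.exp_nat_mul]; norm_num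
    rw [h5]
    have := pow_le_pow_left₀ (by norm_num) he1.le 5
    nlinarith
  have h1 : Real.log (3 * (200 * (T + 4) + 40 * (T + 4) * (7 + L6 / 2))) ≤ 6 + 2 * L6 := by
    have hle : 3 * (200 * (T + 4) + 40 * (T + 4) * (7 + L6 / 2)) ≤ 204 * (T + 6) ^ 2 := by
      rw [hA]; exact hB.trans hC
    have hR : Real.log (204 * (T + 6) ^ 2) = Real.log 204 + 2 * L6 := by
      rw [Real.log_mul (by norm_num) (by positivity), Real.log_pow, hL6]
      push_cast
      ring
    have := Real.log_le_log hMpos hle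
    rw [hR] at this
    linarith
  have h1₀ : 0 ≤ Real.log (3 * (200 * (T + 4) + 40 * (T + 4) * (7 + L6 / 2))) := Real.log_nonneg hM1
  have h2 : Real.log (120 * (T + 4)) ≤ 5 + L6 := by
    rw [Real.log_mul (by norm_num) (by positivity)]
    have := Real.log_le_log (by positivity : (0 : ℝ) < T + 4) (show T + 4 ≤ T + 6 by linarith)
    rw [← hL6] at this
    linarith
  have h2₀ : 0 ≤ Real.log (120 * (T + 4)) := Real.log_nonneg (by linarith)
  -- `1/log(7/6) ≤ 7`
  have hl76 : 1 / 7 ≤ Real.log (7 / 6) := by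
    have := Real.one_sub_inv_le_log_of_pos (show (0 : ℝ) < 7 / 6 by norm_num)
    norm_num at this ⊢
    linarith
  have hl76pos : 0 < Real.log (7 / 6) := by linarith
  set X : ℝ := Real.log (3 * (200 * (T + 4) + 40 * (T + 4) * (7 + L6 / 2))) +
    Real.log (120 * (T + 4))
  have hX0 : 0 ≤ X := add_nonneg h1₀ h2₀
  have hX : X ≤ 11 + 3 * L6 := by linarith
  have hdiv : X / Real.log (7 / 6) ≤ 7 * X := by
    rw [div_le_iff₀ hl76pos]
    nlinarith
  linarith

/-- **Conrey 1983, Lemma 2 for `m = 1` (counting part): `N^{(1)}(T) = N(T) + O(log T)`, explicitly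
`|N^{(1)}(T) − N(T)| ≤ 100 + 25 log(T + 7)` for all `T ≥ T₀`.** Off the ordinates this is
`abs_sub_le_of_not_ordinate`; a general `T` is moved up to a nearby `T′ ∈ (T, T+1)` past no ordinate
of `ζ` or `ξ′`, where both counting functions take the same values. [cite: Conrey1983, Lemma 2 (p. 52)] -/
theorem exists_abs_xiDerivZeroCount_sub_zetaZeroCount_le :
    ∃ T₀ : ℝ, 4 ≤ T₀ ∧ ∀ T : ℝ, T₀ ≤ T →
      |(xiDerivZeroCount 1 T : ℝ) - zetaZeroCount T| ≤ 100 + 25 * Real.log (T + 7) := by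
  obtain ⟨T₁, hT₁, hF⟩ := exists_re_logDeriv_riemannXi_two_add_ge
  refine ⟨T₁, hT₁, fun T hT ↦ ?_⟩
  classical
  -- the finitely many ordinates of zeros of `ζ` and `ξ′` in `(T, T+1]`
  set Zζ : Set ℂ := {ρ ∈ zetaZeroBox 0 (T + 1) | T < ρ.im} with hZζ
  set Zξ : Set ℂ := {ρ ∈ xiDerivZeroBox 1 (T + 1) | T < ρ.im} with hZξ
  have hfinζ : Zζ.Finite := (zetaZeroBox_finite 0 (T + 1)).subset (sep_subset _ _)
  have hfinξ : Zξ.Finite := (xiDerivZeroBox_one_finite (T + 1)).subset (sep_subset _ _)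
  set Fs : Finset ℝ := insert (T + 1)
    ((hfinζ.toFinset.image Complex.im) ∪ (hfinξ.toFinset.image Complex.im)) with hFs
  have hne : Fs.Nonempty := Finset.insert_nonempty _ _
  set m : ℝ := Fs.min' hne with hm
  have hmle : m ≤ T + 1 := Finset.min'_le _ _ (Finset.mem_insert_self _ _)
  have hmgt : T < m := by
    have hmem := Finset.min'_mem Fs hne
    rw [← hm] at hmem
    rcases Finset.mem_insert.1 hmem with h | h
    · linarith
    · rcases Finset.mem_union.1 h with h | h
      · obtain ⟨ρ, hρ, hρm⟩ := Finset.mem_image.1 h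
        rw [Set.Finite.mem_toFinset] at hρ
        rw [← hρm]; exact hρ.2
      · obtain ⟨ρ, hρ, hρm⟩ := Finset.mem_image.1 h
        rw [Set.Finite.mem_toFinset] at hρ
        rw [← hρm]; exact hρ.2
  set T' : ℝ := (T + m) / 2 with hT'
  have hTT' : T < T' := by rw [hT']; linarith
  have hT'1 : T' < T + 1 := by rw [hT']; linarith
  have hT'm : T' < m := by rw [hT']; linarith
  -- no ordinate of `ζ` in `(T, T']`, none of `ξ′`
  have hnoζ : ∀ ρ : ℂ, riemannZeta ρ = 0 → ¬(T < ρ.im ∧ ρ.im ≤ T') := by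
    rintro ρ hζ0 ⟨h1, h2⟩
    have him : ρ.im ≠ 0 := by intro h0; rw [h0] at h1; linarith
    have hst := re_mem_Ioo_of_riemannZeta_eq_zero_of_im_ne_zero hζ0 him
    have hρZ : ρ ∈ Zζ := ⟨⟨hζ0, hst.1.le, hst.2.le, by linarith, by linarith⟩, h1⟩
    have hρF : ρ.im ∈ Fs := Finset.mem_insert_of_mem (Finset.mem_union_left _
      (Finset.mem_image.2 ⟨ρ, (Set.Finite.mem_toFinset hfinζ).2 hρZ, rfl⟩))
    have := Finset.min'_le Fs _ hρF
    rw [← hm] at this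
    linarith
  have hnoξ : ∀ ρ : ℂ, deriv riemannXi ρ = 0 → ¬(T < ρ.im ∧ ρ.im ≤ T') := by
    rintro ρ h0 ⟨h1, h2⟩
    have hρZ : ρ ∈ Zξ := ⟨⟨by rw [iteratedDeriv_one]; exact h0, by linarith, by linarith⟩, h1⟩
    have hρF : ρ.im ∈ Fs := Finset.mem_insert_of_mem (Finset.mem_union_right _
      (Finset.mem_image.2 ⟨ρ, (Set.Finite.mem_toFinset hfinξ).2 hρZ, rfl⟩))
    have := Finset.min'_le Fs _ hρF
    rw [← hm] at this
    linarith
  have hζ' : ∀ ρ : ℂ, riemannZeta ρ = 0 → ρ.im ≠ T' := fun ρ h0 he ↦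
    hnoζ ρ h0 ⟨by rw [he]; exact hTT', he.le⟩
  have hξ'' : ∀ ρ : ℂ, deriv riemannXi ρ = 0 → ρ.im ≠ T' := fun ρ h0 he ↦
    hnoξ ρ h0 ⟨by rw [he]; exact hTT', he.le⟩
  -- the counts agree at `T` and `T'`
  have hN : zetaZeroCount T' = zetaZeroCount T := zetaZeroCount_eq_of_no_ordinate hTT'.le hnoζ
  have hN₁ : xiDerivZeroCount 1 T' = xiDerivZeroCount 1 T := by
    have hbox : xiDerivZeroBox 1 T' = xiDerivZeroBox 1 T := by
      ext ρ
      simp only [xiDerivZeroBox, mem_setOf_eq, iteratedDeriv_one]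
      constructor
      · rintro ⟨h0, h1, h2⟩
        exact ⟨h0, h1, le_of_not_gt fun hlt ↦ hnoξ ρ h0 ⟨hlt, h2⟩⟩
      · rintro ⟨h0, h1, h2⟩
        exact ⟨h0, h1, h2.trans hTT'.le⟩
    unfold xiDerivZeroCount
    rw [hbox]
  have hT'4 : 4 ≤ T' := by linarith
  have hb := abs_sub_le_of_not_ordinate hT'4 (hF T' (by linarith)) hζ' hξ''
  rw [hN, hN₁] at hb
  refine hb.trans ((explicit_bound_le hT'4).trans ?_)
  have := Real.log_le_log (by linarith : (0 : ℝ) < T' + 6) (show T' + 6 ≤ T + 7 by linarith)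
  linarith

end XiDerivArg

/-! ## §7. The theorems -/

/-- **Conrey 1983, Lemma 2 (`m = 1`): `N^{(1)}(T) − N(T) = O(log T)`.** There are `C` and `T₀` with
`|N^{(1)}(T) − N(T)| ≤ C log T` for all `T ≥ T₀`, where `N^{(1)}(T) = xiDerivZeroCount 1 T` counts the
zeros of `ξ′` with `0 < Im s ≤ T` and `N(T) = zetaZeroCount T` those of `ζ` (both with multiplicity).
PROVED by Backlund's argument (argument principle for `ξ′` and `ξ` on `[−1,2] × [−T,T]`, Jensen's
formula on the top edge, `Re ξ′/ξ > 0` on `Re s = 2`). [cite: Conrey1983, Lemma 2 (p. 52)] -/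
theorem exists_abs_xiDerivZeroCount_sub_zetaZeroCount_le_log :
    ∃ C T₀ : ℝ, 0 < T₀ ∧ ∀ T : ℝ, T₀ ≤ T →
      |(xiDerivZeroCount 1 T : ℝ) - zetaZeroCount T| ≤ C * Real.log T := by
  obtain ⟨T₀, hT₀, h⟩ := XiDerivArg.exists_abs_xiDerivZeroCount_sub_zetaZeroCount_le
  refine ⟨150, T₀, by linarith, fun T hT ↦ (h T hT).trans ?_⟩
  have hT4 : 4 ≤ T := hT₀.trans hT
  -- `1 ≤ log T` and `log (T + 7) ≤ 2 log T` for `T ≥ 4`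
  have hlogT : 1 ≤ Real.log T := by
    rw [Real.le_log_iff_exp_le (by linarith)]
    have := Real.exp_one_lt_d9
    linarith
  have h7 : Real.log (T + 7) ≤ 2 * Real.log T := by
    have hsq : T + 7 ≤ T ^ 2 := by nlinarith
    calc Real.log (T + 7) ≤ Real.log (T ^ 2) := Real.log_le_log (by linarith) hsq
      _ = 2 * Real.log T := by rw [Real.log_pow]; push_cast; ring
  linarith

/-- **Conrey 1983, Lemma 2 (`m = 1`), printed form**: `N^{(1)}(T) = (T/2π) log(T/2π) − T/2π + O(log T)`
— from `N^{(1)} − N = O(log T)` and the Riemann–von Mangoldt formula for `N(T)`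
(`riemann_von_mangoldt_holds`). [cite: Conrey1983, Lemma 2 (p. 52)] -/
theorem xiDerivZeroCount_one_riemann_von_mangoldt :
    (fun T : ℝ ↦ (xiDerivZeroCount 1 T : ℝ) - (T / (2 * π) * Real.log (T / (2 * π)) - T / (2 * π)))
      =O[atTop] Real.log := by
  obtain ⟨C, T₀, hT₀, h⟩ := exists_abs_xiDerivZeroCount_sub_zetaZeroCount_le_log
  have h1 : (fun T : ℝ ↦ (xiDerivZeroCount 1 T : ℝ) - zetaZeroCount T) =O[atTop] Real.log := by
    refine Asymptotics.IsBigO.of_bound C ?_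
    filter_upwards [eventually_ge_atTop T₀, eventually_ge_atTop (1 : ℝ)] with T hT hT1
    rw [Real.norm_eq_abs, Real.norm_eq_abs, abs_of_nonneg (Real.log_nonneg hT1)]
    exact h T hT
  have h2 : (fun T : ℝ ↦ (zetaZeroCount T : ℝ) - (T / (2 * π) * Real.log (T / (2 * π)) - T / (2 * π)))
      =O[atTop] Real.log := riemann_von_mangoldt_holds
  refine (h1.add h2).congr_left fun T ↦ ?_
  ring

end Literature.NumberTheory.LFunctions

end
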